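import Mathlib
import Literature.MathematicalPhysics.StatisticalMechanics.LennardJonesClusters
import Summits.AtomisticToContinuum.Crystallization.Theorems.ChessboardParticlePlanesLjLaminarWindowsForceBalance
import HarnessLib

/-!
# The virial identity for Lennard-Jones ground states (zero pressure)

Helper file of line `Sketch`, crux `LjLaminarWindows` (stmt-AtomisticToContinuum-6711): a further
exact identity satisfied by every Lennard-Jones ground state `x : Fin N → ℝᵈ` of
`V_LJ(r) = r⁻¹²/12 - r⁻⁶/6`.  Dilations `x ↦ c x` (`c > 0`) are competitors (they keep the points
distinct), so `c ↦ 𝓔(c x) = ∑_{i<j} V_LJ(c r_{ij})` is minimal at `c = 1` and its derivative there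
vanishes: `∑_{i<j} r_{ij} V_LJ'(r_{ij}) = 0`.  With `r V_LJ'(r) = -r⁻¹² + r⁻⁶` this is the
**virial identity** (`virial_sum_inv_pow_eq`)

  `∑_{i<j} r_{ij}⁻¹² = ∑_{i<j} r_{ij}⁻⁶`,

i.e. the total repulsion equals the total attraction in the `u = r⁻⁶` gauge (zero pressure), and
consequently (`virial_interactionEnergy_eq`) the ground-state energy is carried by either part
alone: `E(N) = 𝓔(x) = -(1/12) ∑_{i<j} r_{ij}⁻⁶ = -(1/12) ∑_{i<j} r_{ij}⁻¹²`.
All statements `[folklore]` (stationarity under dilation; Blanc–Lewin 2015, §1.2).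
-/

noncomputable section

open scoped BigOperators
open Filter Topology
open Literature.MathematicalPhysics.StatisticalMechanics

namespace Summit.AtomisticToContinuum.Crystallization.Theorems.LjLaminarWindowsSketch

variable {d N : ℕ}

/-- **Dilations are competitors.** In a Lennard-Jones ground state, `𝓔(x) ≤ 𝓔(c x)` for every
`c ≠ 0` (the dilated configuration consists of distinct points). [folklore] -/
theorem virial_interactionEnergy_le_smul {x : Fin N → EuclideanSpace ℝ (Fin d)}
    (hx : IsGroundState lennardJones x) {c : ℝ} (hc : c ≠ 0) :
    interactionEnergy lennardJones x ≤ interactionEnergy lennardJones (fun i => c • x i) := by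
  rw [hx.2]
  exact groundStateEnergy_lennardJones_le fun a b hab => hx.1 (smul_right_injective _ hc hab)

/-- The energy of the dilated configuration: `𝓔(c x) = ∑_{i<j} V_LJ(c r_{ij})` for `c > 0`.
[folklore] -/
theorem virial_interactionEnergy_smul (x : Fin N → EuclideanSpace ℝ (Fin d)) {c : ℝ} (hc : 0 < c) :
    interactionEnergy lennardJones (fun i => c • x i) =
      ∑ i, ∑ j ∈ Finset.Ioi i, lennardJones (c * dist (x i) (x j)) := by
  unfold interactionEnergy
  refine Finset.sum_congr rfl fun i _ => Finset.sum_congr rfl fun j _ => ?_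
  rw [dist_smul₀, Real.norm_eq_abs, abs_of_pos hc]

/-- **Virial identity (zero pressure).** In a Lennard-Jones ground state `x : Fin N → ℝᵈ`,
`∑_{i<j} r_{ij}⁻¹² = ∑_{i<j} r_{ij}⁻⁶`: the derivative at `c = 1` of the locally minimal
`c ↦ 𝓔(c x)` is `∑_{i<j} r_{ij} V_LJ'(r_{ij}) = ∑_{i<j} (-r_{ij}⁻¹² + r_{ij}⁻⁶) = 0`. [folklore] -/
theorem virial_sum_inv_pow_eq {x : Fin N → EuclideanSpace ℝ (Fin d)}
    (hx : IsGroundState lennardJones x) :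
    ∑ i, ∑ j ∈ Finset.Ioi i, (dist (x i) (x j))⁻¹ ^ 12 =
      ∑ i, ∑ j ∈ Finset.Ioi i, (dist (x i) (x j))⁻¹ ^ 6 := by
  have hr : ∀ i, ∀ j ∈ Finset.Ioi i, dist (x i) (x j) ≠ 0 := fun i j hj =>
    dist_ne_zero.2 (hx.1.ne (Finset.mem_Ioi.1 hj).ne)
  -- `ψ c = 𝓔(c x)` for `c > 0`
  set ψ : ℝ → ℝ := fun c => ∑ i, ∑ j ∈ Finset.Ioi i, lennardJones (c * dist (x i) (x j)) with hψ
  have hψ1 : ψ 1 = interactionEnergy lennardJones x := by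
    simp only [hψ, one_mul]
    rfl
  have hmin : IsLocalMin ψ 1 := by
    filter_upwards [eventually_gt_nhds (zero_lt_one : (0 : ℝ) < 1)] with c hc
    rw [hψ1]
    change interactionEnergy lennardJones x ≤
      ∑ i, ∑ j ∈ Finset.Ioi i, lennardJones (c * dist (x i) (x j))
    rw [← virial_interactionEnergy_smul x hc]
    exact virial_interactionEnergy_le_smul hx hc.ne'
  -- derivative at `c = 1`
  have hderiv : HasDerivAt ψ (∑ i, ∑ j ∈ Finset.Ioi i,
      -(1 / 12) * (12 * (dist (x i) (x j))⁻¹ ^ 13 - 12 * (dist (x i) (x j))⁻¹ ^ 7) *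
        dist (x i) (x j)) 1 := by
    show HasDerivAt (fun c : ℝ => ∑ i, ∑ j ∈ Finset.Ioi i, lennardJones (c * dist (x i) (x j))) _ 1
    apply HasDerivAt.fun_sum
    intro i _
    apply HasDerivAt.fun_sum
    intro j hj
    have hV : HasDerivAt lennardJones
        (-(1 / 12) * (12 * (dist (x i) (x j))⁻¹ ^ 13 - 12 * (dist (x i) (x j))⁻¹ ^ 7))
        ((1 : ℝ) * dist (x i) (x j)) := by
      rw [one_mul]
      exact forceBalance_hasDerivAt_lennardJones (hr i j hj)
    exact hV.comp (1 : ℝ) (hasDerivAt_mul_const (dist (x i) (x j)))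
  have h0 := hmin.hasDerivAt_eq_zero hderiv
  have hterm : ∀ i, ∀ j ∈ Finset.Ioi i,
      -(1 / 12) * (12 * (dist (x i) (x j))⁻¹ ^ 13 - 12 * (dist (x i) (x j))⁻¹ ^ 7) *
          dist (x i) (x j) =
        -((dist (x i) (x j))⁻¹ ^ 12) + (dist (x i) (x j))⁻¹ ^ 6 := fun i j hj => by
    have h := hr i j hj
    field_simp
    ring
  rw [Finset.sum_congr rfl fun i _ => Finset.sum_congr rfl fun j hj => hterm i j hj] at h0
  simp only [Finset.sum_add_distrib, Finset.sum_neg_distrib] at h0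
  linarith

/-- **Ground-state energy from the attractive part alone.** In a Lennard-Jones ground state,
`𝓔(x) = E(N) = -(1/12) ∑_{i<j} r_{ij}⁻⁶` (insert the virial identity into
`𝓔 = (1/12) ∑ r⁻¹² - (1/6) ∑ r⁻⁶`). [folklore] -/
theorem virial_interactionEnergy_eq {x : Fin N → EuclideanSpace ℝ (Fin d)}
    (hx : IsGroundState lennardJones x) :
    interactionEnergy lennardJones x =
      -(1 / 12) * ∑ i, ∑ j ∈ Finset.Ioi i, (dist (x i) (x j))⁻¹ ^ 6 := by
  have hv := virial_sum_inv_pow_eq hx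
  have hE : interactionEnergy lennardJones x =
      (1 / 12) * ∑ i, ∑ j ∈ Finset.Ioi i, (dist (x i) (x j))⁻¹ ^ 12 -
        (1 / 6) * ∑ i, ∑ j ∈ Finset.Ioi i, (dist (x i) (x j))⁻¹ ^ 6 := by
    unfold interactionEnergy lennardJones
    simp only [Finset.sum_sub_distrib, Finset.mul_sum]
  rw [hE, hv]
  ring

/-- **Ground-state energy from the repulsive part alone.** In a Lennard-Jones ground state,
`𝓔(x) = E(N) = -(1/12) ∑_{i<j} r_{ij}⁻¹²`. [folklore] -/
theorem virial_interactionEnergy_eq' {x : Fin N → EuclideanSpace ℝ (Fin d)}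
    (hx : IsGroundState lennardJones x) :
    interactionEnergy lennardJones x =
      -(1 / 12) * ∑ i, ∑ j ∈ Finset.Ioi i, (dist (x i) (x j))⁻¹ ^ 12 := by
  rw [virial_interactionEnergy_eq hx, virial_sum_inv_pow_eq hx]

/-- **Registered sub-goal `stub_virial` of line `Sketch`: the virial identity for Lennard-Jones
ground states**, `∑_{i<j} r_{ij}⁻¹² = ∑_{i<j} r_{ij}⁻⁶` in every dimension. [folklore] -/
theorem stub_virial :
    ∀ (d N : ℕ) (x : Fin N → EuclideanSpace ℝ (Fin d)), IsGroundState lennardJones x →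
      ∑ i, ∑ j ∈ Finset.Ioi i, (dist (x i) (x j))⁻¹ ^ 12 =
        ∑ i, ∑ j ∈ Finset.Ioi i, (dist (x i) (x j))⁻¹ ^ 6 :=
  fun _ _ _ hx => virial_sum_inv_pow_eq hx

end Summit.AtomisticToContinuum.Crystallization.Theorems.LjLaminarWindowsSketch

end
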